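import Mathlib
import HarnessLib

/-!
# Route `UnthreadedDoor`, crux `PoloidalLiouville` (stmt-NavierStokesRegularity-1222), WALL W1 — crux idea «cell-flux» (ns-idea-14), stub Σ-5a
# `UnthreadedGaugeRigidity`: the ONE-VARIABLE REAL-ANALYTIC DIVISION LEMMA (removable singularity through isolated zeros)

Generic analysis used by the short road to Σ-5a (director-ns KEY-NS #218 (2)(b), owner ns-qj-p1 g7): if `D` and `N` are real-analytic on a
preconnected open set `U ⊆ ℝ`, `D` does not vanish identically, and a CONTINUOUS `z` solves `D t • z t = N t` on `U`, then `z` is real-analytic on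
`U` — at an isolated zero `t₁` of `D` of order `n`, `N` vanishes to order `m ≥ n` (else `‖z‖ → ∞`), so `z = (t − t₁)^{m−n} • h/g` near `t₁`.
* `eq_of_eventuallyEq_punctured` — two functions continuous at `t₁` that agree on a punctured neighbourhood agree at `t₁`;
* `analyticAt_of_smul_eq` — the pointwise statement; `analyticOnNhd_of_smul_eq` — the statement on a preconnected open set.
Vector-valued (`z N : ℝ → F`, `F` a complete normed space), scalar `D`.  Nothing here is specific to Navier–Stokes; no NS regularity statement is
proved.  `--supports stmt-NavierStokesRegularity-1222 --as helper`.  [folklore]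
-/

noncomputable section

-- the summit and its single sub-problem share the name (CONVENTIONS §1)
set_option linter.dupNamespace false

open Set Function Filter Topology

namespace Summit.NavierStokesRegularity.NavierStokesRegularity.Theorems.PoloidalLiouville.CellFlux

variable {F : Type*} [NormedAddCommGroup F] [NormedSpace ℝ F]

omit [NormedSpace ℝ F] in
/-- Two functions continuous at `t₁` which agree on a punctured neighbourhood of `t₁` agree at `t₁`. [folklore] -/
theorem eq_of_eventuallyEq_punctured {f g : ℝ → F} {t₁ : ℝ} (hf : ContinuousAt f t₁) (hg : ContinuousAt g t₁)
    (h : f =ᶠ[𝓝[≠] t₁] g) : f t₁ = g t₁ := by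
  haveI : (𝓝[≠] t₁).NeBot := NormedField.nhdsNE_neBot t₁
  have h1 : Tendsto f (𝓝[≠] t₁) (𝓝 (f t₁)) := hf.tendsto.mono_left nhdsWithin_le_nhds
  have h2 : Tendsto g (𝓝[≠] t₁) (𝓝 (g t₁)) := hg.tendsto.mono_left nhdsWithin_le_nhds
  exact tendsto_nhds_unique (h1.congr' h) h2

/-- A function which agrees on a punctured neighbourhood of `t₁` with a function analytic at `t₁`, both continuous at `t₁`, is analytic at `t₁`.
[folklore] -/
theorem analyticAt_of_eventuallyEq_punctured {z φ : ℝ → F} {t₁ : ℝ} (hz : ContinuousAt z t₁) (hφ : AnalyticAt ℝ φ t₁)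
    (h : z =ᶠ[𝓝[≠] t₁] φ) : AnalyticAt ℝ z t₁ := by
  have h0 : z t₁ = φ t₁ := eq_of_eventuallyEq_punctured hz hφ.continuousAt h
  have hev : z =ᶠ[𝓝 t₁] φ := by
    rw [eventuallyEq_nhdsWithin_iff] at h
    filter_upwards [h] with t ht
    by_cases hne : t = t₁
    · rw [hne, h0]
    · exact ht hne
  exact hφ.congr hev.symm

/-- **Real-analytic division at a point.**  `D` analytic at `t₁` and not identically zero near `t₁`, `N` analytic at `t₁`, `z` continuous at `t₁`,
and `D t • z t = N t` near `t₁` ⇒ `z` is analytic at `t₁`. [folklore] -/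
theorem analyticAt_of_smul_eq [CompleteSpace F] {D : ℝ → ℝ} {N z : ℝ → F} {t₁ : ℝ}
    (hD : AnalyticAt ℝ D t₁) (hDne : ¬ ∀ᶠ t in 𝓝 t₁, D t = 0) (hN : AnalyticAt ℝ N t₁) (hz : ContinuousAt z t₁)
    (heq : ∀ᶠ t in 𝓝 t₁, D t • z t = N t) : AnalyticAt ℝ z t₁ := by
  obtain ⟨n, g, hg, hg0, hDeq⟩ := (hD.exists_eventuallyEq_pow_smul_nonzero_iff).2 hDne
  -- `g ≠ 0` near `t₁`
  have hgne : ∀ᶠ t in 𝓝 t₁, g t ≠ 0 := hg.continuousAt.eventually_ne hg0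
  -- on a punctured neighbourhood, `(t - t₁)^n * g t ≠ 0`
  have hpunct : ∀ᶠ t in 𝓝[≠] t₁, t ≠ t₁ := self_mem_nhdsWithin
  by_cases hN0 : ∀ᶠ t in 𝓝 t₁, N t = 0
  · -- `N ≡ 0` near `t₁`: then `z = 0` on a punctured neighbourhood, hence near `t₁`
    refine analyticAt_of_eventuallyEq_punctured hz (analyticAt_const (v := (0 : F))) ?_
    filter_upwards [hpunct, mem_nhdsWithin_of_mem_nhds hDeq, mem_nhdsWithin_of_mem_nhds hgne,
      mem_nhdsWithin_of_mem_nhds heq, mem_nhdsWithin_of_mem_nhds hN0] with t ht hDt hgt het hNt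
    have hDt0 : D t ≠ 0 := by
      rw [hDt, smul_eq_mul]
      exact mul_ne_zero (pow_ne_zero _ (sub_ne_zero.2 ht)) hgt
    rw [hNt] at het
    exact (smul_eq_zero.1 het).resolve_left hDt0
  · obtain ⟨m, h, hh, hh0, hNeq⟩ := (hN.exists_eventuallyEq_pow_smul_nonzero_iff).2 hN0
    -- the identity `(t - t₁)^n * g t • z t = (t - t₁)^m • h t` near `t₁`
    have hid : ∀ᶠ t in 𝓝 t₁, ((t - t₁) ^ n * g t) • z t = (t - t₁) ^ m • h t := by
      filter_upwards [hDeq, hNeq, heq] with t hDt hNt het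
      rw [← hNt, ← het, hDt, smul_eq_mul]
    rcases le_or_gt n m with hnm | hmn
    · -- `m ≥ n`: `z = (t - t₁)^(m-n) • (g t)⁻¹ • h t` near `t₁`
      set φ : ℝ → F := fun t => ((t - t₁) ^ (m - n) * (g t)⁻¹) • h t with hφ
      have hφa : AnalyticAt ℝ φ t₁ :=
        (((analyticAt_id.sub analyticAt_const).pow _).mul (hg.inv hg0)).smul hh
      refine analyticAt_of_eventuallyEq_punctured hz hφa ?_
      filter_upwards [hpunct, mem_nhdsWithin_of_mem_nhds hid, mem_nhdsWithin_of_mem_nhds hgne] with t ht hidt hgt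
      have hpow : (t - t₁) ^ n ≠ 0 := pow_ne_zero _ (sub_ne_zero.2 ht)
      have hsplit : (t - t₁) ^ m = (t - t₁) ^ n * (t - t₁) ^ (m - n) := by
        rw [← pow_add, Nat.add_sub_cancel' hnm]
      -- cancel `(t - t₁)^n * g t`
      have h1 : ((t - t₁) ^ n * g t) • z t = ((t - t₁) ^ n * g t) • φ t := by
        rw [hidt, hφ]
        simp only [smul_smul]
        congr 1
        rw [hsplit]
        field_simp
      exact smul_right_injective F (mul_ne_zero hpow hgt) h1
    · -- `m < n`: impossible — `(t - t₁)^(n-m) * g t • z t = h t` near `t₁`, and the left side vanishes at `t₁`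
      exfalso
      set ψ : ℝ → F := fun t => ((t - t₁) ^ (n - m) * g t) • z t with hψ
      have hψc : ContinuousAt ψ t₁ :=
        ((continuousAt_id.sub continuousAt_const).pow _).mul hg.continuousAt |>.smul hz
      have hψh : ψ =ᶠ[𝓝[≠] t₁] h := by
        filter_upwards [hpunct, mem_nhdsWithin_of_mem_nhds hid] with t ht hidt
        have hpow : (t - t₁) ^ m ≠ 0 := pow_ne_zero _ (sub_ne_zero.2 ht)
        have hsplit : (t - t₁) ^ n = (t - t₁) ^ m * (t - t₁) ^ (n - m) := by
          rw [← pow_add, Nat.add_sub_cancel' hmn.le]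
        have h1 : (t - t₁) ^ m • ψ t = (t - t₁) ^ m • h t := by
          rw [← hidt, hψ, smul_smul, hsplit]
          ring_nf
        exact smul_right_injective F hpow h1
      have hval := eq_of_eventuallyEq_punctured hψc hh.continuousAt hψh
      have hψ0 : ψ t₁ = 0 := by
        simp only [hψ, sub_self]
        rw [zero_pow (Nat.sub_ne_zero_of_lt hmn), zero_mul, zero_smul]
      exact hh0 (hval ▸ hψ0)

/-- **Real-analytic division on a preconnected open set.**  `D`, `N` analytic on the open preconnected `U ⊆ ℝ`, `D t₀ ≠ 0` for some `t₀ ∈ U`,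
`z` continuous on `U`, `D t • z t = N t` on `U` ⇒ `z` analytic on `U`. [folklore] -/
theorem analyticOnNhd_of_smul_eq [CompleteSpace F] {D : ℝ → ℝ} {N z : ℝ → F} {U : Set ℝ} (hU : IsOpen U) (hUc : IsPreconnected U)
    (hD : AnalyticOnNhd ℝ D U) (hN : AnalyticOnNhd ℝ N U) (hz : ContinuousOn z U)
    (heq : ∀ t ∈ U, D t • z t = N t) {t₀ : ℝ} (ht₀ : t₀ ∈ U) (hD0 : D t₀ ≠ 0) :
    AnalyticOnNhd ℝ z U := by
  intro t₁ ht₁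
  have hDne : ¬ ∀ᶠ t in 𝓝 t₁, D t = 0 := by
    intro hzero
    have h := hD.eqOn_zero_of_preconnected_of_eventuallyEq_zero hUc ht₁ hzero ht₀
    exact hD0 h
  have hmem : ∀ᶠ t in 𝓝 t₁, t ∈ U := hU.mem_nhds ht₁
  exact analyticAt_of_smul_eq (hD t₁ ht₁) hDne (hN t₁ ht₁) (hz.continuousAt (hU.mem_nhds ht₁))
    (hmem.mono fun t ht => heq t ht)

end Summit.NavierStokesRegularity.NavierStokesRegularity.Theorems.PoloidalLiouville.CellFlux

end
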